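import Literature.Probability.RandomPlanarGeometry.HexSAWArmchairSecondOrder
import Literature.Probability.RandomPlanarGeometry.HexSAWArmchairSecondOrderLower
import HarnessLib

/-!
# Beaton's ROTATED (armchair) honeycomb surface: the THREE-SEED RENEWAL inequality and the third-order term from BELOW —
# `y² B^w_{n+10} + 2y⁴ B^w_{n+2} + 2y⁴ B^w_n ≤ B^w_{n+14}`, hence `y²/β_rot⁴ + 2y⁴/β_rot¹² + 2y⁴/β_rot¹⁴ ≤ 1` and
# `β_rot(y)⁴ ≥ y² + 2 + 2/y − 137802/y²` (`y ≥ 175`) and **`liminf_{y→∞} y²(β_rot(y)² − y − 1/y) ≥ 1`**: the THIRD coefficient of the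
# armchair adsorbed-phase expansion is AT LEAST the zig-zag value `1`

Topic `Literature/Probability/RandomPlanarGeometry` (lane «pcv-sawmu», car «ARM-THIRD-ORDER-LOWER», a-p6 g15).  Inputs: the junction
concatenation `Arm.jcat` / `jcat_spec` / `Zd.concatWalk_injective_pieces` of `HexSAWArmchairWallBridges` (as in `mul_WB_le`), the five
explicit SEEDS of `HexSAWArmchairSecondOrderLower` — the dimer `zzWalk 1`, the seven-step bridges `Defect.skipW 9 0`, `Defect.wideW 9 0`
(length `9`, four visits) and the nine-step bridges `Defect.nineA 11 0`, `Defect.nineB 11 0` (length `11`, four visits) —, the a-priori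
`B^w_n ≤ β_rot^{n+3}` (`WB_le_pow`) and, for the extraction, the UPPER bound `β_rot⁴ ≤ y² + 2 + 15309/√y` of `HexSAWArmchairSecondOrder`.
(Lengths are kept symbolic — `4k+1`, `4k+3` with `k = 2` — in every membership statement: closed numerals inside `wb _` make the
elaborator enumerate the finset.)

Sources.  N. Madras, G. Slade, *The Self-Avoiding Walk* (1993), §1.2 ((1.2.15)–(1.2.17)), §4.2.  J. M. Hammersley, G. M. Torrie,
S. G. Whittington, J. Phys. A 15 (1982) 539, §2 (as summarised by Beaton 2014 arXiv v3 p. 11; locator provisional).  N. R. Beaton,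
CMP 326 (2014) = arXiv:1210.0274v3, §3.1 (p. 12).

## What is proved (namespace `…SAW.HexBW.Arm`, then `…SAW.HV`)

* §1 `jcat_apply_X`, `jcat_apply_prefix_end`, `jcat_apply_junction_two` (coordinates of a junction concatenation); `sum_seedFamily_eq` /
  `seedFamily_subset` (the family `wb n₁ × P ↦ jcat`, injective, weights multiply).  §2 the seeds (symbolic lengths): `dimer_seed`,
  `seven_seeds`, `nine_seeds` (memberships, visits, test coordinates, distinctness).
* §3 ★★★ **`WB_three_seed (n) : y²·B^w_{n+10} + 2y⁴·B^w_{n+2} + 2y⁴·B^w_n ≤ B^w_{n+14}`** (three pairwise-disjoint families, by `X` at times `n+10`, `n+2`).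
* §4 `renewal_unbounded₇` (window-minimum growth lemma, lags `2,6,7`).  §5 `WB_pos_of_four_le`; ★★★ **`three_seed_renewal_ineq (0 < y) :
  y²/β_rot⁴ + 2y⁴/β_rot¹² + 2y⁴/β_rot¹⁴ ≤ 1`**.
* §6 ★★ `armRate_pow_four_ge_third (175 ≤ y) : y² + 2 + 2/y − 137802/y² ≤ β_rot⁴`; ★★★ **`sq_mul_armRate_sq_sub_sub_ge (300 ≤ y) :
  1 − 68903/y ≤ y²(β_rot² − y − 1/y)`**; ★★★ `eventually_sq_mul_armRate_sq_sub_sub_ge` (liminf ≥ 1); `armRate_sq_sub_sub_mem_Icc`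
  (`β_rot² − y − 1/y ∈ [(1 − 68903/y)/y², 7655/(y√y)]`).  §7 `HV.sq_mul_rotSurfaceMu_sq_sub_sub_ge`, `HV.eventually_sq_mul_rotSurfaceMu_sq_sub_sub_ge`.

HONEST LABEL (author's proposal).  LANE THEOREM (S) / NEW-IN-WRITING (modest, S): «for Beaton's rotated-honeycomb surface model,
μ_rot(y)² ≥ y + 1/y + 1/y² − O(y^{−5/2})-type: liminf y²(μ_rot² − y − 1/y) ≥ 1» — the armchair third coefficient is at least the zig-zag
one (`HexSAWSurfaceThirdOrder`: exactly `1` there).  CONJECTURE (a-ref-1 g56 census `a₈↑ = 0`, `a₉↑ = 2`): equality.  NOT CLAIMED: the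
matching upper bound (the two-step-alive class of «ARM-SECOND-ORDER-UPPER» gives only `+O(y^{−3/2})`), anything below `y = 175`/`300`.
-/

noncomputable section

open Finset Filter
open Literature.Probability.LatticeModels Literature.Probability.Percolation SimpleGraph
open _root_.Topology

namespace Literature.Probability.RandomPlanarGeometry.SAW.HexBW.Arm

variable {y : ℝ} {n : ℕ}

/-! ### §1  Junction concatenation with a fixed seed -/

/-- After the junction the `X`-coordinate is the seed's: `jcat n₁ ω υ (n₁ + (3 + j)) 0 = υ j 0` (the prefix ends on the wall).
[cite: MadrasSlade1993, §1.2, (1.2.15); HammersleyTorrieWhittington1982, §2] -/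
theorem jcat_apply_X {n₁ n₂ : ℕ} {ω υ : ℕ → Site 2} (hω : ω ∈ wb n₁) (hυ : υ ∈ wb n₂) (j : ℕ) :
    jcat n₁ ω υ (n₁ + (3 + j)) 0 = υ j 0 := by
  have hT := tailPiece_mem_zd hυ
  have hT0 : tailPiece υ 0 = 0 := (Zd.mem_saws.1 hT).1
  have hυ0 : υ 0 = 0 := (mem_saws_iff.1 (wb_anatomy hυ).1).1
  have hend : ω n₁ 0 = 0 := (wb_anatomy hω).2.2.1
  rw [jcat, Zd.concatWalk_apply_add _ _ hT0, Pi.add_apply, hend, zero_add, tailPiece_apply_add hυ0, Pi.add_apply, pt_apply_zero,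
    zero_add]

/-- At the prefix end the concatenation is on the wall. [cite: MadrasSlade1993, §1.2, (1.2.15)] -/
theorem jcat_apply_prefix_end {n₁ : ℕ} {ω : ℕ → Site 2} (hω : ω ∈ wb n₁) (υ : ℕ → Site 2) : jcat n₁ ω υ n₁ 0 = 0 := by
  have := Zd.concatWalk_apply_of_le ω (tailPiece υ) (le_refl n₁)
  rw [jcat, this]; exact (wb_anatomy hω).2.2.1

/-- Two steps into the junction the walk is OFF the wall (`X = 1`). [cite: EntingJensen2009, §7.4.2, Fig. 7.10] -/
theorem jcat_apply_junction_two {n₁ n₂ : ℕ} {ω υ : ℕ → Site 2} (hω : ω ∈ wb n₁) (hυ : υ ∈ wb n₂) :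
    jcat n₁ ω υ (n₁ + 2) 0 = 1 := by
  have hT := tailPiece_mem_zd hυ
  have hT0 : tailPiece υ 0 = 0 := (Zd.mem_saws.1 hT).1
  have hend : ω n₁ 0 = 0 := (wb_anatomy hω).2.2.1
  rw [jcat, Zd.concatWalk_apply_add _ _ hT0, Pi.add_apply, hend, zero_add, tailPiece_apply_of_le υ (by norm_num : 2 ≤ 3), conn_two,
    pt_apply_zero]

open Classical in
/-- **The seed family**: for a finite set `P` of wall bridges of length `n₂`, the map `(ω, υ) ↦ jcat n₁ ω υ` is injective on `wb n₁ × P`,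
lands in `wb (n₁ + 3 + n₂)` and adds visits; hence `B^w_{n₁}(y) · Σ_{υ ∈ P} y^{visits υ} ≤ Σ_{image} y^{visits}`. [cite: MadrasSlade1993, §1.2, (1.2.15)] -/
theorem sum_seedFamily_eq {n₁ n₂ : ℕ} {P : Finset (ℕ → Site 2)} (hP : P ⊆ wb n₂) (y : ℝ) :
    ∑ ζ ∈ (wb n₁ ×ˢ P).image (fun p => jcat n₁ p.1 p.2), y ^ visits (n₁ + (3 + n₂)) ζ =
      WB n₁ y * ∑ υ ∈ P, y ^ visits n₂ υ := by
  have hinj : Set.InjOn (fun p : (ℕ → Site 2) × (ℕ → Site 2) => jcat n₁ p.1 p.2) ↑(wb n₁ ×ˢ P) := by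
    rintro ⟨ω, υ⟩ hp ⟨ω', υ'⟩ hp' h
    rw [Finset.mem_coe, Finset.mem_product] at hp hp'
    dsimp only at h
    have hωs := (wb_anatomy hp.1).1
    have hω's := (wb_anatomy hp'.1).1
    have hυs := (wb_anatomy (hP hp.2)).1
    have hυ's := (wb_anatomy (hP hp'.2)).1
    obtain ⟨h1, h2⟩ := Zd.concatWalk_injective_pieces (saws_subset _ hωs) (tailPiece_mem_zd (hP hp.2))
      (saws_subset _ hω's) (tailPiece_mem_zd (hP hp'.2)) h
    have h3 := tailPiece_injective (mem_saws_iff.1 hυs).1 (mem_saws_iff.1 hυ's).1 h2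
    simp only [Prod.mk.injEq]
    exact ⟨h1, h3⟩
  rw [Finset.sum_image hinj, Finset.sum_product, WB, Finset.sum_mul]
  refine Finset.sum_congr rfl fun ω hω => ?_
  rw [Finset.mul_sum]
  refine Finset.sum_congr rfl fun υ hυ => ?_
  dsimp only
  rw [(jcat_spec hω (hP hυ)).2, pow_add]

open Classical in
/-- The seed family lies in `wb (n₁ + 3 + n₂)`. [cite: MadrasSlade1993, §1.2, (1.2.15)] -/
theorem seedFamily_subset {n₁ n₂ : ℕ} {P : Finset (ℕ → Site 2)} (hP : P ⊆ wb n₂) :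
    (wb n₁ ×ˢ P).image (fun p => jcat n₁ p.1 p.2) ⊆ wb (n₁ + (3 + n₂)) := by
  intro ζ hζ
  obtain ⟨p, hp, rfl⟩ := Finset.mem_image.1 hζ
  rw [Finset.mem_product] at hp
  exact (jcat_spec hp.1 (hP hp.2)).1

/-! ### §2  The five seeds (symbolic lengths `4k+1`, `4k+3` with `k = 2`, and `4·0+1`) -/

/-- The dimer seed: a wall bridge of length `4·0+1` with `2` visits, on the wall at time `0`. [cite: Beaton2014RotatedHoneycomb, §3.1 (arXiv v3 p. 14)] -/
theorem dimer_seed : zzWalk (4 * 0 + 1) ∈ wb (4 * 0 + 1) ∧ visits (4 * 0 + 1) (zzWalk (4 * 0 + 1)) = 2 * 0 + 2 :=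
  ⟨zzWalk_mem_wb 0, Defect.visits_zzWalk 0⟩

/-- The seven-step seeds at `k = 2` (length `4k+1 = 9`, `2k = 4` visits), distinct, with `X = 2` resp. `3` at time `5`.
[cite: Beaton2014RotatedHoneycomb, §3.1 (arXiv v3 p. 12)] -/
theorem seven_seeds {k : ℕ} (hk : k = 2) :
    Defect.skipW (4 * k + 1) 0 ∈ wb (4 * k + 1) ∧ visits (4 * k + 1) (Defect.skipW (4 * k + 1) 0) = 2 * k ∧
    Defect.wideW (4 * k + 1) 0 ∈ wb (4 * k + 1) ∧ visits (4 * k + 1) (Defect.wideW (4 * k + 1) 0) = 2 * k ∧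
    Defect.skipW (4 * k + 1) 0 5 0 = 2 ∧ Defect.wideW (4 * k + 1) 0 5 0 = 3 ∧ Defect.skipW (4 * k + 1) 0 ≠ Defect.wideW (4 * k + 1) 0 := by
  have hX1 : Defect.skipW (4 * k + 1) 0 5 0 = 2 := by
    simp only [Defect.skipW, min_eq_left (show 5 ≤ 4 * k + 1 by omega), Defect.sX]
    split_ifs <;> simp only [Defect.zz_X, pt_apply_zero] <;> push_cast <;> omega
  have hX2 : Defect.wideW (4 * k + 1) 0 5 0 = 3 := by
    simp only [Defect.wideW, min_eq_left (show 5 ≤ 4 * k + 1 by omega), Defect.wX]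
    split_ifs <;> simp only [Defect.zz_X, pt_apply_zero] <;> push_cast <;> omega
  refine ⟨Defect.skipW_mem_wb (by omega), Defect.visits_skipW (by omega), Defect.wideW_mem_wb (by omega), Defect.visits_wideW (by omega),
    hX1, hX2, fun h => ?_⟩
  have := congrFun (congrFun h 5) 0
  rw [hX1, hX2] at this; norm_num at this

/-- The nine-step seeds at `k = 2` (length `4k+3 = 11`, `2k = 4` visits), distinct, with `X = 2` resp. `3` at time `7`.
[cite: Beaton2014RotatedHoneycomb, §3.1 (arXiv v3 p. 12)] -/
theorem nine_seeds {k : ℕ} (hk : k = 2) :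
    Defect.nineA (4 * k + 3) 0 ∈ wb (4 * k + 3) ∧ visits (4 * k + 3) (Defect.nineA (4 * k + 3) 0) = 2 * k ∧
    Defect.nineB (4 * k + 3) 0 ∈ wb (4 * k + 3) ∧ visits (4 * k + 3) (Defect.nineB (4 * k + 3) 0) = 2 * k ∧
    Defect.nineA (4 * k + 3) 0 7 0 = 2 ∧ Defect.nineB (4 * k + 3) 0 7 0 = 3 ∧ Defect.nineA (4 * k + 3) 0 ≠ Defect.nineB (4 * k + 3) 0 := by
  have hX1 : Defect.nineA (4 * k + 3) 0 7 0 = 2 := by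
    simp only [Defect.nineA, min_eq_left (show 7 ≤ 4 * k + 3 by omega), Defect.aX, Defect.aY]
    split_ifs <;> simp only [Defect.zz_X, pt_apply_zero] <;> push_cast <;> omega
  have hX2 : Defect.nineB (4 * k + 3) 0 7 0 = 3 := by
    simp only [Defect.nineB, min_eq_left (show 7 ≤ 4 * k + 3 by omega), Defect.bX, Defect.bY]
    split_ifs <;> simp only [Defect.zz_X, pt_apply_zero] <;> push_cast <;> omega
  obtain ⟨hvA, hvB⟩ := Defect.visits_nine (k := k) (j := 0) (by omega)
  refine ⟨Defect.nineA_mem_wb (by omega), hvA, Defect.nineB_mem_wb (by omega), hvB, hX1, hX2, fun h => ?_⟩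
  have := congrFun (congrFun h 7) 0
  rw [hX1, hX2] at this; norm_num at this

/-! ### §3  The three-seed renewal inequality -/

set_option maxHeartbeats 400000 in
open Classical in
/-- ★★★ **Three-seed renewal inequality** (`y ≥ 0`, every `n`):
`y² · B^w_{n+10}(y) + 2y⁴ · B^w_{n+2}(y) + 2y⁴ · B^w_n(y) ≤ B^w_{n+14}(y)`.
The three families «prefix ⊕ junction ⊕ seed» with seeds the dimer (after a prefix of length `n+10`), the two seven-step bridges (prefix
`n+2`) and the two nine-step bridges (prefix `n`) are pairwise disjoint subsets of `wb (n+14)` (read `X` at times `n+10` and `n+2`), each in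
bijection with `wb(prefix) × seeds`. [cite: MadrasSlade1993, §1.2, (1.2.15)–(1.2.17); HammersleyTorrieWhittington1982, §2 (as summarised by Beaton 2014 arXiv v3 p. 11; locator provisional)] -/
theorem WB_three_seed (n : ℕ) (hy : 0 ≤ y) :
    y ^ 2 * WB (n + 10) y + 2 * y ^ 4 * WB (n + 2) y + 2 * y ^ 4 * WB n y ≤ WB (n + 14) y := by
  obtain ⟨k, hk⟩ : ∃ k : ℕ, k = 2 := ⟨2, rfl⟩
  obtain ⟨hS, hvS, hW, hvW, hS5, hW5, hSW⟩ := seven_seeds hk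
  obtain ⟨hA, hvA, hB, hvB, hA7, hB7, hAB⟩ := nine_seeds hk
  obtain ⟨hD, hvD⟩ := dimer_seed
  -- the seed sets
  set PD : Finset (ℕ → Site 2) := {zzWalk (4 * 0 + 1)} with hPD
  set PS : Finset (ℕ → Site 2) := {Defect.skipW (4 * k + 1) 0, Defect.wideW (4 * k + 1) 0} with hPS
  set PN : Finset (ℕ → Site 2) := {Defect.nineA (4 * k + 3) 0, Defect.nineB (4 * k + 3) 0} with hPN
  have hPDsub : PD ⊆ wb (4 * 0 + 1) := by rw [hPD]; exact Finset.singleton_subset_iff.2 hD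
  have hPSsub : PS ⊆ wb (4 * k + 1) := by
    rw [hPS]; exact Finset.insert_subset_iff.2 ⟨hS, Finset.singleton_subset_iff.2 hW⟩
  have hPNsub : PN ⊆ wb (4 * k + 3) := by
    rw [hPN]; exact Finset.insert_subset_iff.2 ⟨hA, Finset.singleton_subset_iff.2 hB⟩
  -- the families
  set FD := (wb (n + 10) ×ˢ PD).image (fun p => jcat (n + 10) p.1 p.2) with hFD
  set FS := (wb (n + 2) ×ˢ PS).image (fun p => jcat (n + 2) p.1 p.2) with hFS
  set FN := (wb n ×ˢ PN).image (fun p => jcat n p.1 p.2) with hFN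
  have eD : n + 10 + (3 + (4 * 0 + 1)) = n + 14 := by omega
  have eS : n + 2 + (3 + (4 * k + 1)) = n + 14 := by omega
  have eN : n + (3 + (4 * k + 3)) = n + 14 := by omega
  have hFDsub : FD ⊆ wb (n + 14) := by have := seedFamily_subset (n₁ := n + 10) hPDsub; rwa [eD] at this
  have hFSsub : FS ⊆ wb (n + 14) := by have := seedFamily_subset (n₁ := n + 2) hPSsub; rwa [eS] at this
  have hFNsub : FN ⊆ wb (n + 14) := by have := seedFamily_subset (n₁ := n) hPNsub; rwa [eN] at this
  -- sums of the families
  have sD : ∑ ζ ∈ FD, y ^ visits (n + 14) ζ = y ^ 2 * WB (n + 10) y := by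
    have := sum_seedFamily_eq (n₁ := n + 10) hPDsub y
    rw [eD] at this
    rw [hFD, this, hPD, Finset.sum_singleton, hvD]; ring
  have sS : ∑ ζ ∈ FS, y ^ visits (n + 14) ζ = 2 * y ^ 4 * WB (n + 2) y := by
    have := sum_seedFamily_eq (n₁ := n + 2) hPSsub y
    rw [eS] at this
    rw [hFS, this, hPS, Finset.sum_pair hSW, hvS, hvW, hk]; ring
  have sN : ∑ ζ ∈ FN, y ^ visits (n + 14) ζ = 2 * y ^ 4 * WB n y := by
    have := sum_seedFamily_eq (n₁ := n) hPNsub y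
    rw [eN] at this
    rw [hFN, this, hPN, Finset.sum_pair hAB, hvA, hvB, hk]; ring
  -- pairwise disjointness by reading `X` at times `n + 10` and `n + 2`
  have memFD : ∀ ζ ∈ FD, ζ (n + 10) 0 = 0 := by
    intro ζ hζ
    obtain ⟨⟨ω, υ⟩, hp, rfl⟩ := Finset.mem_image.1 hζ
    rw [Finset.mem_product] at hp
    exact jcat_apply_prefix_end hp.1 υ
  have memFS : ∀ ζ ∈ FS, ζ (n + 10) 0 ≠ 0 ∧ ζ (n + 2) 0 = 0 := by
    intro ζ hζ
    obtain ⟨⟨ω, υ⟩, hp, rfl⟩ := Finset.mem_image.1 hζ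
    rw [Finset.mem_product] at hp
    refine ⟨?_, jcat_apply_prefix_end hp.1 υ⟩
    dsimp only
    have h := jcat_apply_X hp.1 (hPSsub hp.2) 5
    rw [show n + 2 + (3 + 5) = n + 10 by omega] at h
    rw [h]
    have hυ : υ ∈ PS := hp.2
    rw [hPS, Finset.mem_insert, Finset.mem_singleton] at hυ
    rcases hυ with rfl | rfl
    · dsimp only; rw [hS5]; norm_num
    · dsimp only; rw [hW5]; norm_num
  have memFN : ∀ ζ ∈ FN, ζ (n + 10) 0 ≠ 0 ∧ ζ (n + 2) 0 ≠ 0 := by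
    intro ζ hζ
    obtain ⟨⟨ω, υ⟩, hp, rfl⟩ := Finset.mem_image.1 hζ
    rw [Finset.mem_product] at hp
    dsimp only
    constructor
    · have h := jcat_apply_X hp.1 (hPNsub hp.2) 7
      rw [show n + (3 + 7) = n + 10 by omega] at h
      rw [h]
      have hυ : υ ∈ PN := hp.2
      rw [hPN, Finset.mem_insert, Finset.mem_singleton] at hυ
      rcases hυ with rfl | rfl
      · dsimp only; rw [hA7]; norm_num
      · dsimp only; rw [hB7]; norm_num
    · rw [jcat_apply_junction_two hp.1 (hPNsub hp.2)]; norm_num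
  have dDS : Disjoint FD FS := Finset.disjoint_left.2 fun ζ h1 h2 => (memFS ζ h2).1 (memFD ζ h1)
  have dDN : Disjoint FD FN := Finset.disjoint_left.2 fun ζ h1 h2 => (memFN ζ h2).1 (memFD ζ h1)
  have dSN : Disjoint FS FN := Finset.disjoint_left.2 fun ζ h1 h2 => (memFN ζ h2).2 (memFS ζ h1).2
  have dU : Disjoint (FD ∪ FS) FN := Finset.disjoint_union_left.2 ⟨dDN, dSN⟩
  have hsub : FD ∪ FS ∪ FN ⊆ wb (n + 14) := Finset.union_subset (Finset.union_subset hFDsub hFSsub) hFNsub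
  calc y ^ 2 * WB (n + 10) y + 2 * y ^ 4 * WB (n + 2) y + 2 * y ^ 4 * WB n y
      = ∑ ζ ∈ FD ∪ FS ∪ FN, y ^ visits (n + 14) ζ := by
        rw [Finset.sum_union dU, Finset.sum_union dDS, sD, sS, sN]
    _ ≤ WB (n + 14) y := Finset.sum_le_sum_of_subset_of_nonneg hsub fun _ _ _ => pow_nonneg hy _

/-! ### §4  A window-minimum renewal lemma (lags `2, 6, 7` in half-length) -/

/-- The minimum of seven consecutive terms. [cite: MadrasSlade1993, §1.2, Lemma 1.2.2] -/
def win7 (e : ℕ → ℝ) (m : ℕ) : ℝ :=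
  min (min (min (min (min (min (e m) (e (m + 1))) (e (m + 2))) (e (m + 3))) (e (m + 4))) (e (m + 5))) (e (m + 6))

/-- `win7 e m ≤ e (m + j)` for `j ≤ 6`. [cite: MadrasSlade1993, §1.2, Lemma 1.2.2] -/
theorem win7_le (e : ℕ → ℝ) (m : ℕ) {j : ℕ} (hj : j ≤ 6) : win7 e m ≤ e (m + j) := by
  have hcase : j = 0 ∨ j = 1 ∨ j = 2 ∨ j = 3 ∨ j = 4 ∨ j = 5 ∨ j = 6 := by omega
  unfold win7
  rcases hcase with rfl | rfl | rfl | rfl | rfl | rfl | rfl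
  · simp only [add_zero]
    exact le_trans (min_le_left _ _) (le_trans (min_le_left _ _) (le_trans (min_le_left _ _)
      (le_trans (min_le_left _ _) (le_trans (min_le_left _ _) (min_le_left _ _)))))
  · exact le_trans (min_le_left _ _) (le_trans (min_le_left _ _) (le_trans (min_le_left _ _)
      (le_trans (min_le_left _ _) (le_trans (min_le_left _ _) (min_le_right _ _)))))
  · exact le_trans (min_le_left _ _) (le_trans (min_le_left _ _) (le_trans (min_le_left _ _)
      (le_trans (min_le_left _ _) (min_le_right _ _))))
  · exact le_trans (min_le_left _ _) (le_trans (min_le_left _ _) (le_trans (min_le_left _ _) (min_le_right _ _)))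
  · exact le_trans (min_le_left _ _) (le_trans (min_le_left _ _) (min_le_right _ _))
  · exact le_trans (min_le_left _ _) (min_le_right _ _)
  · exact min_le_right _ _

/-- A common lower bound of seven consecutive terms bounds the window minimum. [cite: MadrasSlade1993, §1.2, Lemma 1.2.2] -/
theorem le_win7 {e : ℕ → ℝ} {m : ℕ} {c : ℝ} (h : ∀ j ≤ 6, c ≤ e (m + j)) : c ≤ win7 e m := by
  unfold win7
  have h0 := h 0 (by norm_num); have h1 := h 1 (by norm_num); have h2 := h 2 (by norm_num)
  have h3 := h 3 (by norm_num); have h4 := h 4 (by norm_num); have h5 := h 5 (by norm_num); have h6 := h 6 (by norm_num)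
  simp only [add_zero] at h0
  exact le_min (le_min (le_min (le_min (le_min (le_min h0 h1) h2) h3) h4) h5) h6

/-- **Renewal growth lemma** (lags `2, 6, 7`): a nonnegative `e` with `e (m+7) ≥ a e (m+5) + b e (m+1) + c e m` (`a,b,c ≥ 0`,
`a + b + c > 1`), positive on a window of seven, is unbounded. [cite: MadrasSlade1993, §1.2, Lemma 1.2.2; §4.2] -/
theorem renewal_unbounded₇ {e : ℕ → ℝ} {a b c : ℝ} (ha : 0 ≤ a) (hb : 0 ≤ b) (hc : 0 ≤ c) (hq : 1 < a + b + c)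
    (hrec : ∀ m, a * e (m + 5) + b * e (m + 1) + c * e m ≤ e (m + 7)) (hnn : ∀ m, 0 ≤ e m)
    {m₀ : ℕ} (hpos : 0 < win7 e m₀) : ∀ C : ℝ, ∃ m, C < e m := by
  set q := a + b + c with hq_def
  have hq0 : 0 ≤ q := by linarith
  have hstep : ∀ m, q * win7 e m ≤ e (m + 7) := by
    intro m
    have h5 := win7_le e m (j := 5) (by norm_num)
    have h1 := win7_le e m (j := 1) (by norm_num)
    have h0 := win7_le e m (j := 0) (by norm_num)
    simp only [add_zero] at h0
    have := hrec m
    nlinarith [mul_le_mul_of_nonneg_left h5 ha, mul_le_mul_of_nonneg_left h1 hb, mul_le_mul_of_nonneg_left h0 hc]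
  have hmono : ∀ m, win7 e m ≤ win7 e (m + 1) := by
    intro m
    refine le_win7 fun j hj => ?_
    rcases Nat.lt_or_ge j 6 with hj6 | hj6
    · have := win7_le e m (j := j + 1) (by omega); rwa [show m + (j + 1) = m + 1 + j by omega] at this
    · have hj' : j = 6 := by omega
      subst hj'
      have hw0 : 0 ≤ win7 e m := le_win7 fun j _ => hnn _
      have := hstep m
      rw [show m + 1 + 6 = m + 7 by omega]
      nlinarith
  have hmono' : ∀ m k, win7 e m ≤ win7 e (m + k) := by
    intro m k; induction k with
    | zero => simp
    | succ k ih => exact ih.trans (by rw [← add_assoc]; exact hmono _)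
  have hgain : ∀ m, q * win7 e m ≤ win7 e (m + 7) := by
    intro m
    refine le_win7 fun j hj => ?_
    have h1 := hstep (m + j)
    rw [show m + j + 7 = m + 7 + j by omega] at h1
    have h2 := hmono' m j
    nlinarith [mul_le_mul_of_nonneg_left h2 hq0]
  have hpow : ∀ t : ℕ, q ^ t * win7 e m₀ ≤ win7 e (m₀ + 7 * t) := by
    intro t; induction t with
    | zero => simp
    | succ t ih =>
      have h1 := hgain (m₀ + 7 * t)
      rw [show m₀ + 7 * t + 7 = m₀ + 7 * (t + 1) by ring] at h1
      calc q ^ (t + 1) * win7 e m₀ = q * (q ^ t * win7 e m₀) := by ring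
        _ ≤ q * win7 e (m₀ + 7 * t) := mul_le_mul_of_nonneg_left ih hq0
        _ ≤ win7 e (m₀ + 7 * (t + 1)) := h1
  intro C
  have hlim : Tendsto (fun t : ℕ => q ^ t * win7 e m₀) atTop atTop :=
    (tendsto_pow_atTop_atTop_of_one_lt hq).atTop_mul_const hpos
  obtain ⟨t, ht⟩ := (hlim.eventually_gt_atTop C).exists
  refine ⟨m₀ + 7 * t, ?_⟩
  have h1 := hpow t
  have h2 := win7_le e (m₀ + 7 * t) (j := 0) (by norm_num)
  simp only [add_zero] at h2
  linarith

/-! ### §5  The renewal inequality for `β_rot` -/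

/-- `B^w_{2m+1}(y) > 0` for `4 ≤ m` (`y > 0`): the zig-zag (`m` even) or the nine-step defect bridges (`m` odd, `B^w_{4k+3} ≥ 2(k−1)y^{2k}`).
[cite: Beaton2014RotatedHoneycomb, §3.1 (arXiv v3 p. 12)] -/
theorem WB_pos_of_four_le (hy : 0 < y) {m : ℕ} (hm : 4 ≤ m) : 0 < WB (2 * m + 1) y := by
  rcases Nat.even_or_odd m with ⟨k, hk⟩ | ⟨k, hk⟩
  · rw [show 2 * m + 1 = 4 * k + 1 by omega]; exact WB_pos hy k
  · rw [show 2 * m + 1 = 4 * k + 3 by omega]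
    refine lt_of_lt_of_le ?_ (Defect.WB_ge_nine_defect hy.le k)
    have hk2 : (2 : ℝ) ≤ (k : ℝ) := by exact_mod_cast (show 2 ≤ k by omega)
    have : (0 : ℝ) < (k : ℝ) - 1 := by linarith
    positivity

/-- ★★★ **The three-seed renewal inequality for the growth rate**: `y²/β_rot⁴ + 2y⁴/β_rot¹² + 2y⁴/β_rot¹⁴ ≤ 1` for every `y > 0`
(`e_m := B^w_{2m+1}/β_rot^{2m}` is bounded by `β_rot⁴` and satisfies the lag-`(2,6,7)` renewal inequality with these coefficients).
[cite: MadrasSlade1993, §1.2, (1.2.17); §4.2; Beaton2014RotatedHoneycomb, §3.1 (arXiv v3 p. 12)] -/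
theorem three_seed_renewal_ineq (hy : 0 < y) :
    y ^ 2 / armRate y ^ 4 + 2 * y ^ 4 / armRate y ^ 12 + 2 * y ^ 4 / armRate y ^ 14 ≤ 1 := by
  set β := armRate y with hβ
  have hβ0 : 0 < β := armRate_pos y
  set e : ℕ → ℝ := fun m => WB (2 * m + 1) y / β ^ (2 * m) with he
  have hnn : ∀ m, 0 ≤ e m := fun m => div_nonneg (WB_nonneg _ hy.le) (by positivity)
  have hbd : ∀ m, e m ≤ β ^ 4 := by
    intro m
    have h1 := WB_le_pow hy (2 * m + 1)
    rw [show 2 * m + 1 + 3 = 2 * m + 4 by omega, pow_add] at h1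
    simp only [he]
    rw [div_le_iff₀ (by positivity)]; linarith
  have hrec : ∀ m, y ^ 2 / β ^ 4 * e (m + 5) + 2 * y ^ 4 / β ^ 12 * e (m + 1) + 2 * y ^ 4 / β ^ 14 * e m ≤ e (m + 7) := by
    intro m
    simp only [he]
    have h3 := WB_three_seed (2 * m + 1) hy.le
    rw [show 2 * m + 1 + 10 = 2 * (m + 5) + 1 by ring, show 2 * m + 1 + 2 = 2 * (m + 1) + 1 by ring,
      show 2 * m + 1 + 14 = 2 * (m + 7) + 1 by ring] at h3
    have e1 : y ^ 2 / β ^ 4 * (WB (2 * (m + 5) + 1) y / β ^ (2 * (m + 5))) = y ^ 2 * WB (2 * (m + 5) + 1) y / β ^ (2 * (m + 7)) := by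
      field_simp; ring
    have e2 : 2 * y ^ 4 / β ^ 12 * (WB (2 * (m + 1) + 1) y / β ^ (2 * (m + 1))) = 2 * y ^ 4 * WB (2 * (m + 1) + 1) y / β ^ (2 * (m + 7)) := by
      field_simp; ring
    have e3 : 2 * y ^ 4 / β ^ 14 * (WB (2 * m + 1) y / β ^ (2 * m)) = 2 * y ^ 4 * WB (2 * m + 1) y / β ^ (2 * (m + 7)) := by
      field_simp; ring
    rw [e1, e2, e3, ← add_div, ← add_div]
    exact div_le_div_of_nonneg_right h3 (by positivity)
  have hpos : 0 < win7 e 4 := by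
    have p : ∀ j, j ≤ 6 → 0 < e (4 + j) := fun j hj => div_pos (WB_pos_of_four_le hy (by omega)) (by positivity)
    have hmin : 0 < min (min (min (min (min (min (e 4) (e 5)) (e 6)) (e 7)) (e 8)) (e 9)) (e 10) :=
      lt_min (lt_min (lt_min (lt_min (lt_min (lt_min (p 0 (by norm_num)) (p 1 (by norm_num))) (p 2 (by norm_num)))
        (p 3 (by norm_num))) (p 4 (by norm_num))) (p 5 (by norm_num))) (p 6 (by norm_num))
    exact hmin
  by_contra hgt
  push Not at hgt
  obtain ⟨m, hm⟩ := renewal_unbounded₇ (by positivity) (by positivity) (by positivity) hgt hrec hnn hpos (β ^ 4)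
  exact absurd (hbd m) (not_le.2 hm)

/-! ### §6  Extraction: `β_rot⁴ ≥ y² + 2 + 2/y − O(y⁻²)` and the third-order lower bound -/

set_option maxHeartbeats 400000 in
/-- **`β_rot(y)⁴ ≥ y² + 2 + 2/y − 137802/y²`** for `y ≥ 175` (the renewal inequality times `β_rot⁴`, with the UPPER car's
`β_rot⁴ ≤ y² + 2 + 15309/√y` and `β_rot² ≤ y + 7657/y` in the denominators). [cite: MadrasSlade1993, §1.2, (1.2.17); §4.2; Beaton2014RotatedHoneycomb, §3.1 (arXiv v3 p. 12)] -/
theorem armRate_pow_four_ge_third (hy : 175 ≤ y) : y ^ 2 + 2 + 2 / y - 137802 / y ^ 2 ≤ armRate y ^ 4 := by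
  have hy1 : 1 ≤ y := by linarith
  have hy0 : 0 < y := by linarith
  have hβ0 : 0 < armRate y := armRate_pos y
  set B := armRate y ^ 4 with hB
  set b := armRate y ^ 2 with hb
  have hB0 : 0 < B := by positivity
  have hb0 : 0 < b := by positivity
  have hren := three_seed_renewal_ineq hy0
  have e12 : armRate y ^ 12 = B * B * B := by rw [hB]; ring
  have e14 : armRate y ^ 14 = B * B * B * b := by rw [hB, hb]; ring
  rw [e12, e14] at hren
  -- times `B`
  have hmain : y ^ 2 + 2 * y ^ 4 / (B * B) + 2 * y ^ 4 / (B * B * b) ≤ B := by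
    have := mul_le_mul_of_nonneg_left hren hB0.le
    rw [mul_one] at this
    have e : B * (y ^ 2 / B + 2 * y ^ 4 / (B * B * B) + 2 * y ^ 4 / (B * B * B * b)) =
        y ^ 2 + 2 * y ^ 4 / (B * B) + 2 * y ^ 4 / (B * B * b) := by field_simp
    linarith [e]
  -- the UPPER inputs
  set U := y ^ 2 + 2 + 15309 / Real.sqrt y with hU
  have hs1 : 1 ≤ Real.sqrt y := by rw [← Real.sqrt_one]; exact Real.sqrt_le_sqrt hy1
  have hs0 : 0 < Real.sqrt y := by positivity
  have hBU : B ≤ U := armRate_pow_four_le hy1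
  have hUle : U ≤ y ^ 2 + 15311 := by
    have : 15309 / Real.sqrt y ≤ 15309 := by rw [div_le_iff₀ hs0]; nlinarith
    rw [hU]; linarith
  have hU0 : 0 < U := lt_of_lt_of_le hB0 hBU
  have hbV : b ≤ y + 7657 / y := by
    have h := armRate_sq_le_second hy1
    have : 7655 / (y * Real.sqrt y) ≤ 7655 / y := by
      apply div_le_div_of_nonneg_left (by norm_num) hy0; nlinarith
    have e : 1 / y + 7655 / y = 7656 / y := by rw [← add_div]; norm_num
    have : 7656 / y ≤ 7657 / y := div_le_div_of_nonneg_right (by norm_num) hy0.le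
    rw [hb]; linarith
  have hV0 : 0 < y + 7657 / y := by positivity
  -- `y⁴/U² ≥ 1 − 30622/y²`
  have hq : 1 - 15311 / y ^ 2 ≤ y ^ 2 / U := by
    have hW : y ^ 2 / (y ^ 2 + 15311) ≤ y ^ 2 / U := div_le_div_of_nonneg_left (by positivity) hU0 hUle
    have eW : y ^ 2 / (y ^ 2 + 15311) = 1 - 15311 / (y ^ 2 + 15311) := by
      rw [eq_sub_iff_add_eq, ← add_div, div_self (ne_of_gt (by positivity))]
    have h3 : 15311 / (y ^ 2 + 15311) ≤ 15311 / y ^ 2 :=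
      div_le_div_of_nonneg_left (by norm_num) (by positivity) (by linarith)
    linarith
  have hq0 : 0 ≤ 1 - 15311 / y ^ 2 := by rw [sub_nonneg, div_le_one (by positivity)]; nlinarith
  have hsq : 1 - 30622 / y ^ 2 ≤ y ^ 4 / (U * U) := by
    have hmul := mul_le_mul hq hq hq0 (le_trans hq0 hq)
    have e30 : (30622 : ℝ) / y ^ 2 = 2 * (15311 / y ^ 2) := by ring
    calc 1 - 30622 / y ^ 2 ≤ (1 - 15311 / y ^ 2) * (1 - 15311 / y ^ 2) := by rw [e30]; nlinarith [sq_nonneg (15311 / y ^ 2)]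
      _ ≤ y ^ 2 / U * (y ^ 2 / U) := hmul
      _ = y ^ 4 / (U * U) := by rw [div_mul_div_comm]; ring
  -- first correction term
  have hT1 : 2 - 61244 / y ^ 2 ≤ 2 * y ^ 4 / (B * B) := by
    have h1 : 2 * y ^ 4 / (U * U) ≤ 2 * y ^ 4 / (B * B) :=
      div_le_div_of_nonneg_left (by positivity) (by positivity) (mul_le_mul hBU hBU hB0.le hU0.le)
    have e : 2 * y ^ 4 / (U * U) = 2 * (y ^ 4 / (U * U)) := by ring
    have e61 : (61244 : ℝ) / y ^ 2 = 2 * (30622 / y ^ 2) := by ring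
    linarith [hsq]
  -- second correction term
  have hT2 : 2 / y - 76558 / y ^ 3 ≤ 2 * y ^ 4 / (B * B * b) := by
    have h1 : 2 * y ^ 4 / (U * U * (y + 7657 / y)) ≤ 2 * y ^ 4 / (B * B * b) :=
      div_le_div_of_nonneg_left (by positivity) (by positivity)
        (mul_le_mul (mul_le_mul hBU hBU hB0.le hU0.le) hbV hb0.le (by positivity))
    refine le_trans ?_ h1
    have hW0 : 0 < U * U * (y + 7657 / y) := by positivity
    rw [le_div_iff₀ hW0]
    -- `(2/y − 76558/y³) · (U² (y + 7657/y)) ≤ 2 y⁴`, using `U² ≤ y⁴/(1 − 30622/y²)`-type bound in the form `(1 − 30622/y²) U² ≤ y⁴`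
    have hU2 : (1 - 30622 / y ^ 2) * (U * U) ≤ y ^ 4 := by
      have := hsq; rwa [le_div_iff₀ (by positivity)] at this
    have hpos2 : 0 ≤ 2 - 61244 / y ^ 2 := by rw [sub_nonneg, div_le_iff₀ (by positivity)]; nlinarith
    have e2 : (2 / y - 76558 / y ^ 3) * (U * U * (y + 7657 / y)) =
        (U * U) * ((2 - 61244 / y ^ 2) - 76558 * 7657 / y ^ 4) := by field_simp; ring
    rw [e2]
    have hC : 0 ≤ (76558 * 7657 : ℝ) / y ^ 4 := by positivity
    have hUU : 0 ≤ U * U := by positivity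
    calc U * U * (2 - 61244 / y ^ 2 - 76558 * 7657 / y ^ 4) ≤ U * U * (2 - 61244 / y ^ 2) := by
          apply mul_le_mul_of_nonneg_left _ hUU; linarith
      _ = 2 * ((1 - 30622 / y ^ 2) * (U * U)) := by ring
      _ ≤ 2 * y ^ 4 := by linarith
  have h3 : 76558 / y ^ 3 ≤ 76558 / y ^ 2 := by
    apply div_le_div_of_nonneg_left (by norm_num) (by positivity); nlinarith [pow_pos hy0 2]
  have e : y ^ 2 + 2 + 2 / y - 137802 / y ^ 2 = y ^ 2 + (2 - 61244 / y ^ 2) + (2 / y - 76558 / y ^ 2) := by ring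
  rw [e]
  linarith

/-- ★★★ **Third-order LOWER bound for the armchair wall**: `1 − 68903/y ≤ y² · (β_rot(y)² − y − 1/y)` for `y ≥ 300`.
(From `β_rot⁴ ≥ y² + a`, `a = 2 + 2/y − 137802/y²`, via `√(y² + a) ≥ y + a/(2y) − a²/(8y³)`.)  Hence
`liminf_{y→∞} y²(β_rot² − y − 1/y) ≥ 1`: the third coefficient of the armchair adsorbed-phase expansion is AT LEAST the zig-zag value `1`.
[cite: Beaton2014RotatedHoneycomb, §3.1 (arXiv v3 p. 12); MadrasSlade1993, §1.2, (1.2.17)] -/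
theorem sq_mul_armRate_sq_sub_sub_ge (hy : 300 ≤ y) : 1 - 68903 / y ≤ y ^ 2 * (armRate y ^ 2 - y - 1 / y) := by
  have hy0 : 0 < y := by linarith
  have h4 := armRate_pow_four_ge_third (by linarith)
  set a : ℝ := 2 + 2 / y - 137802 / y ^ 2 with ha
  have ha0 : 0 ≤ a := by
    rw [ha]
    have : 137802 / y ^ 2 ≤ 2 := by rw [div_le_iff₀ (by positivity)]; nlinarith
    have : 0 ≤ 2 / y := by positivity
    linarith
  have ha4 : a ≤ 4 := by
    rw [ha]
    have : 2 / y ≤ 2 := by rw [div_le_iff₀ hy0]; nlinarith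
    have : 0 ≤ 137802 / y ^ 2 := by positivity
    linarith
  have hsq := sqrt_lower_aux hy0 ha0 (by nlinarith) (by positivity : (0 : ℝ) ≤ armRate y ^ 2)
    (by rw [show (armRate y ^ 2) ^ 2 = armRate y ^ 4 by ring, ha]; linarith)
  -- `y²(β² − y − 1/y) ≥ y²(a/(2y) − 1/y − a²/(8y³)) = y(a − 2)/2 − a²/(8y)`
  have e : y ^ 2 * (y + a / (2 * y) - a ^ 2 / (8 * y ^ 3) - y - 1 / y) = 1 - 68901 / y - a ^ 2 / (8 * y) := by
    rw [ha]; field_simp; ring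
  have h1 : y ^ 2 * (y + a / (2 * y) - a ^ 2 / (8 * y ^ 3) - y - 1 / y) ≤ y ^ 2 * (armRate y ^ 2 - y - 1 / y) :=
    mul_le_mul_of_nonneg_left (by linarith) (by positivity)
  have h2 : a ^ 2 / (8 * y) ≤ 2 / y := by
    have ha16 : a ^ 2 ≤ 16 := by nlinarith
    rw [div_le_div_iff₀ (by positivity) hy0]; nlinarith
  have e2 : 1 - 68903 / y = 1 - 68901 / y - 2 / y := by ring
  linarith

/-- ★★★ **`liminf_{y→∞} y²(β_rot(y)² − y − 1/y) ≥ 1`**: for every `ε > 0`, eventually `1 − ε ≤ y²(β_rot² − y − 1/y)`.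
[cite: Beaton2014RotatedHoneycomb, §3.1 (arXiv v3 p. 12)] -/
theorem eventually_sq_mul_armRate_sq_sub_sub_ge {ε : ℝ} (hε : 0 < ε) :
    ∀ᶠ y : ℝ in atTop, 1 - ε ≤ y ^ 2 * (armRate y ^ 2 - y - 1 / y) := by
  have h1 : Tendsto (fun y : ℝ => (68903 : ℝ) / y) atTop (𝓝 0) := tendsto_const_nhds.div_atTop tendsto_id
  filter_upwards [eventually_ge_atTop (300 : ℝ), (tendsto_order.1 h1).2 ε hε] with y hy hlt
  linarith [sq_mul_armRate_sq_sub_sub_ge hy]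

/-- **Third-order window, lower half, with the UPPER car's second-order window**: `β_rot² − y − 1/y ∈ [(1 − 68903/y)/y², 7655/(y√y)]` (`y ≥ 300`).
[cite: Beaton2014RotatedHoneycomb, §3.1 (arXiv v3 p. 12)] -/
theorem armRate_sq_sub_sub_mem_Icc (hy : 300 ≤ y) :
    armRate y ^ 2 - y - 1 / y ∈ Set.Icc ((1 - 68903 / y) / y ^ 2) (7655 / (y * Real.sqrt y)) := by
  have hy0 : 0 < y := by linarith
  refine ⟨?_, ?_⟩
  · rw [div_le_iff₀ (by positivity)]
    have := sq_mul_armRate_sq_sub_sub_ge hy; linarith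
  · have := armRate_sq_le_second (by linarith : (1 : ℝ) ≤ y); linarith

end Literature.Probability.RandomPlanarGeometry.SAW.HexBW.Arm

/-! ### §7  Transfer to Beaton's `μ_rot = HV.rotSurfaceMu` (`y ≥ 4`) -/

namespace Literature.Probability.RandomPlanarGeometry.SAW.HV

open Literature.Probability.RandomPlanarGeometry.SAW.HexBW.Arm

variable {y : ℝ}

/-- ★★★ **`1 − 68903/y ≤ y²(μ_rot(y)² − y − 1/y)`** for `y ≥ 300`: `liminf y²(μ_rot² − y − 1/y) ≥ 1` for Beaton's rotated model.
[cite: Beaton2014RotatedHoneycomb, Proposition 7 (arXiv v3 p. 11), §3.1 (p. 12)] -/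
theorem sq_mul_rotSurfaceMu_sq_sub_sub_ge (hy : 300 ≤ y) : 1 - 68903 / y ≤ y ^ 2 * (rotSurfaceMu y ^ 2 - y - 1 / y) := by
  rw [rotSurfaceMu_eq_armRate_of_four_le (by linarith)]; exact sq_mul_armRate_sq_sub_sub_ge hy

/-- ★★★ Eventually `1 − ε ≤ y²(μ_rot(y)² − y − 1/y)`. [cite: Beaton2014RotatedHoneycomb, Proposition 7 (arXiv v3 p. 11), §3.1 (p. 12)] -/
theorem eventually_sq_mul_rotSurfaceMu_sq_sub_sub_ge {ε : ℝ} (hε : 0 < ε) :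
    ∀ᶠ y : ℝ in atTop, 1 - ε ≤ y ^ 2 * (rotSurfaceMu y ^ 2 - y - 1 / y) := by
  filter_upwards [eventually_sq_mul_armRate_sq_sub_sub_ge hε, eventually_ge_atTop (4 : ℝ)] with y h hy
  rwa [rotSurfaceMu_eq_armRate_of_four_le hy]

end Literature.Probability.RandomPlanarGeometry.SAW.HV
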